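import Summits.BirchSwinnertonDyer.BirchSwinnertonDyer.Theorems.AdditiveBranchIMCGordTwoTwistedLogLevel
import Summits.BirchSwinnertonDyer.BirchSwinnertonDyer.Theorems.AdditiveBranchIMCGordTwoTwistedWanDefs
import Summits.BirchSwinnertonDyer.BirchSwinnertonDyer.Theorems.SchneiderFreeAdditiveX3KYReadEmbAtCompat
import Summits.BirchSwinnertonDyer.BirchSwinnertonDyer.Theorems.SchneiderFreeAdditiveX3BranchIMCRebaseHeight
import Summits.BirchSwinnertonDyer.Rank1Residual.ManinAdditive.TwistOrbitManinNearInvariance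
import Summits.BirchSwinnertonDyer.Rank1Residual.X11b.BDPRouteLocalIndexTransport
import HarnessLib
import HarnessLib.Audit.Tags

/-!
# Route `AdditiveBranchIMC`, crux `GordTwoRankZeroOffCaseOne` (stmt-BirchSwinnertonDyer-19357), line `three_field_road`:
# THE LOGARITHM TRANSPORT ON THE TWISTED ROAD — the registered kernel stub `stub_logTransportTwistedR0` (skeleton v41), PROVED

Cell `bsd-addord` (HOME `run/shared/lean/pub/bsd-addord/`), seat `cruxlead-19357` gen 16; `--supports stmt-BirchSwinnertonDyer-19357`.
HONEST FRAMING: a theorem about `p`-adic logarithms of points under the twist isomorphism and Galois descent; it proves nothing printed by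
Liu–Zhang–Zhang, Hsieh or Castella–Liu–Wan, says nothing about `L`-functions, and does not advance BSD; the crux stays OPEN (its other
registered stubs are `stub_residualR0` [research] and `stub_printedFactsR0` [cite-only]).

## What is proved
* §1 `padicLog_map_eq_mul_logOmega_of_descent_of_norm_Δ_eq` — the door cell's twist descent of the logarithm
  (`SchneiderFree.KYRead.LogDescent.padicLog_map_eq_mul_logOmega_of_descent`, Silverman III.1 Table 3.1 read on `log = ∫ω`) with its
  hypothesis `p ∤ Δ_{W′}` (good partner) REPLACED by `‖Δ_W‖ = ‖Δ_{W′}‖` in `F` (two minimal models related by a twist by a `p`-unit at odd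
  `p`): then the composite change of variables `C₂ · ι_θ⁻¹ · D` has `‖u‖ = 1`, so `log_{ω_{W′}}(j_* z) = λ · e(log_{ω_W} Q)` with
  `λ = j(θ)·(u_{C₂}u_D)⁻¹` of norm ONE.
* §2 `norm_Δ_baseChange_eq_of_twist` — for globally minimal `W`, `W₁` with `C • W^{(d₁)} = W₁`, `p` odd, `p ∤ d₁`:
  `‖Δ_{W₁}‖ = ‖Δ_W‖` in any `F ⊇ ℚ_p` (tree `ManinAdditive.padicValInt_minimalDiscriminantInt_le_of_smul_quadraticTwist` both ways).
* §3 ★ `logTransport_twisted` — THE STATEMENT `LogTransportTwistedR0` OF THE SKELETON v41 (same binder list, `p ≠ 2`): for a twisted road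
  field `K` at `q`, the minimal `W₁` with `C • E^{(q*)} = W₁`, a point `y ∈ W₁(H_K)`, a square root `θ ∈ H_K` of `q*` with sign cocycle `s`
  and the character `ν = s`: the Galois descent `Q ∈ E(K)` of `Φ(Σ_τ s(τ)τy)` (tree `SchneiderFree.exists_descent_twistedHeegner`, height
  clause included) satisfies, at every datum `ι′` inducing a degree-one `𝔭′`,
  `heegnerCharLogSum ι′ w₀.embedding 1 W₁ ν y = λ · log_{ω_E}(Q)` read at `embAt K p 𝔭′`, `‖λ‖ = 1` — assembled from
  `heegnerCharLogSum_eq_padicLog_map_sum` (the weighted sum IS the logarithm of the twisted trace; file `…TwistedLogLevel`), §1, §2, and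
  the door cell's `symm_apply_eq_embAt_of_forall_mem_iff_norm_lt_one` (`ι′⁻¹ ∘ w₀.embedding = embAt K p 𝔭′` on `K`).

References: Silverman *AEC* III.1 Table 3.1, IV.6.4, VII.1–2, X.5 Cor. 5.4; Castella–Hsieh, Math. Ann. 370 (2018) §3.3; Liu–Zhang–Zhang,
Duke 167 (2018) (1.5).
-/

noncomputable section

open scoped Classical NNReal

open WeierstrassCurve NumberField IsDedekindDomain Field
  Literature.NumberTheory.EllipticCurves
  Literature.NumberTheory.EllipticCurves.FormalGroupChart
  Literature.NumberTheory.EllipticCurves.LiuZhangZhang2018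
  Summit.BirchSwinnertonDyer.Rank1Residual
  Summit.BirchSwinnertonDyer.Rank1Residual.X11b
  Summit.BirchSwinnertonDyer.Rank1Residual.X11b.Halves
  Summit.BirchSwinnertonDyer.BirchSwinnertonDyer.Theorems.SchneiderFree
  Summit.BirchSwinnertonDyer.BirchSwinnertonDyer.Theorems.SchneiderFree.KYRead.LogDescent

set_option linter.dupNamespace false
set_option autoImplicit false

namespace Summit.BirchSwinnertonDyer.BirchSwinnertonDyer.Theorems.TwistedWanRoad

/-! ## §1 The twist descent of the logarithm, with `‖Δ_W‖ = ‖Δ_{W′}‖` in place of `p ∤ Δ_{W′}` -/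

section Descent

variable (p : ℕ) [Fact p.Prime] (W' : WeierstrassCurve ℚ) [W'.IsGloballyMinimal]
  (D C₂ : VariableChange ℚ) [(D • W').IsCharNeTwoNF] (d : ℚ)
  [(C₂ • (D • W').quadraticTwist d).IsElliptic] [(C₂ • (D • W').quadraticTwist d).IsGloballyMinimal]
  {K : Type} [Field K] [NumberField K] {L : Type*} [Field L] [Algebra ℚ L] [Algebra K L]
  {F : Type} [NontriviallyNormedField F] [IsUltrametricDist F] [CompleteSpace F] [CharZero F]

/-- **Twist descent of the `p`-adic logarithm between two minimal models** (`W = C₂ • ((D • W′) ⊗ χ_d)`, `θ² = d` in `L ⊇ K`,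
`z ∈ W′(L)`, `Q ∈ W(K)` with the descent equation `Q = ι_{C₂}(ι_θ⁻¹(ι_D z))`), in any complete nonarchimedean `F ⊇ ℚ_p` (structure map
`e` isometric) along `ι_p : K → ℚ_p`, `j : L → F` with `j|_K = e ∘ ι_p`, PROVIDED `‖Δ_W‖ = ‖Δ_{W′}‖` in `F`: then the composite change
of variables `C₂ · ι_{jθ}⁻¹ · D` carrying `W′_F` to `W_F` has `|u|¹² = |Δ_{W′}|/|Δ_W| = 1`, and
`log_{ω_{W′}}(j_* z) = λ · e(log_{ω_W}(Q))` with `λ = j(θ)·(u_{C₂}u_D)⁻¹ = u⁻¹` of norm `1` (the door cell's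
`padicLog_map_eq_mul_logOmega_of_descent`, whose `p ∤ Δ_{W′}` served only to bound `|u| ≥ 1`).
[cite: SilvermanAEC2009, III.1 Table 3.1 with Thm. IV.6.4 and X.5 Cor. 5.4] -/
theorem padicLog_map_eq_mul_logOmega_of_descent_of_norm_Δ_eq
    {θ : L} (hθ2 : θ ^ 2 = algebraMap ℚ L d) (hθ : θ ≠ 0)
    (z : (W'.baseChange L).toAffine.Point)
    (Q : ((C₂ • (D • W').quadraticTwist d).baseChange K).toAffine.Point)
    (hQ : WeierstrassCurve.Affine.Point.map (algebraMap K L).toRatAlgHom Q =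
      VariableChange.pointEquivBaseChange ((D • W').quadraticTwist d) C₂ L
        ((VariableChange.pointEquiv (((D • W').quadraticTwist d).baseChange L) (untwistAt hθ)).symm
          ((Affine.Point.congrEquiv (untwistAt_smul_eq (D • W') hθ2 hθ)).symm
            (VariableChange.pointEquivBaseChange W' D L z))))
    (ι_p : K →+* ℚ_[p]) (e : ℚ_[p] →+* F) (he : ∀ x, ‖e x‖ = ‖x‖) (j : L →+* F)
    (hj : ∀ x : K, j (algebraMap K L x) = e (ι_p x))
    (hΔn : ‖((C₂ • (D • W').quadraticTwist d).baseChange F).Δ‖ = ‖(W'.baseChange F).Δ‖) :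
    haveI := isIntegral_valuation_baseChange W' F
    ‖j θ * (algebraMap ℚ F (C₂.u * D.u : ℚ))⁻¹‖ = 1 ∧
    padicLogPointFiniteExt NormedField.valuation (W'.baseChange F) p
        (WeierstrassCurve.Affine.Point.map j.toRatAlgHom z) =
      j θ * (algebraMap ℚ F (C₂.u * D.u : ℚ))⁻¹ *
        e (logOmega (C₂ • (D • W').quadraticTwist d) p ι_p Q) := by
  haveI hintW' := isIntegral_valuation_baseChange W' F
  haveI hintW := isIntegral_valuation_baseChange (C₂ • (D • W').quadraticTwist d) F
  obtain ⟨hp0', hp1'⟩ := natCast_ne_zero_and_val_lt_one_of_isometry p e he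
  -- the square root of `d` in `F`
  have hj'app : ∀ x, j.toRatAlgHom x = j x := fun x ↦ rfl
  have hθ'2 : (j θ) ^ 2 = algebraMap ℚ F d := by
    rw [← map_pow, hθ2, ← hj'app, AlgHom.commutes]
  have hθ'0 : j θ ≠ 0 := (map_ne_zero j).mpr hθ
  -- the composite change of variables over `F` and the model equality
  have hCV := compositeChange_smul (L := F) W' D C₂ d hθ'2 hθ'0
  haveI hintC : ((C₂.map (algebraMap ℚ F) * ((untwistAt hθ'0)⁻¹ * D.map (algebraMap ℚ F))) •
      W'.baseChange F).IsIntegral (NormedField.valuation (K := F)).integer := by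
    rw [hCV]; exact hintW
  -- Step A: the descent equation read in `F`
  have hcomp : (j.toRatAlgHom).comp (algebraMap K L).toRatAlgHom =
      (e.toRatAlgHom).comp ι_p.toRatAlgHom := by
    apply AlgHom.ext
    intro x
    simp only [AlgHom.coe_comp, Function.comp_apply, RingHom.toRatAlgHom_apply]
    exact hj x
  have hjθ : j.toRatAlgHom θ = (((1 : ℤˣ) : ℤ) : F) * j θ := by
    rw [Units.val_one, Int.cast_one, one_mul]; rfl
  have hQC : WeierstrassCurve.Affine.Point.map e.toRatAlgHom
      (X11b.padicPointOf (C₂ • (D • W').quadraticTwist d) p ι_p Q) =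
      Affine.Point.congrEquiv hCV (VariableChange.pointMap (W'.baseChange F)
        (C₂.map (algebraMap ℚ F) * ((untwistAt hθ'0)⁻¹ * D.map (algebraMap ℚ F)))
        (WeierstrassCurve.Affine.Point.map j.toRatAlgHom z)) := by
    rw [X11b.padicPointOf, WeierstrassCurve.Affine.Point.map_map, ← hcomp,
      ← WeierstrassCurve.Affine.Point.map_map, hQ, VariableChange.pointEquivBaseChange_map,
      map_untwist_symm_of_eq_units (D • W') hθ2 hθ hθ'2 hθ'0 j.toRatAlgHom 1 hjθ,
      Units.val_one, one_zsmul, VariableChange.pointEquivBaseChange_map,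
      descendedPoint_eq_congrEquiv_pointMap W' D C₂ d hθ'2 hθ'0]
  -- Step B: the receptacle's logarithm read in `F`, and a multiple of `Q` in the level
  obtain ⟨hlogQ, hmQ, hm⟩ :=
    map_logOmega_eq_padicLogPointFiniteExt p e he (C₂ • (D • W').quadraticTwist d) ι_p Q
  rw [hQC, ← map_nsmul, congrEquiv_mem_level_iff hCV] at hmQ
  rw [hQC, padicLogPointFiniteExt_congrEquiv hCV] at hlogQ
  -- Step C′: `‖u‖ = 1` from `Δ_W = u⁻¹² Δ_{W′}` and `‖Δ_W‖ = ‖Δ_{W′}‖`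
  have hΔ0 : (W'.baseChange F).Δ ≠ 0 := by
    have h := (norm_Δ_baseChange p e he W').1
    intro h0
    have hrel : ((C₂ • (D • W').quadraticTwist d).baseChange F).Δ = 0 := by
      rw [← hCV, variableChange_Δ, h0, mul_zero]
    haveI : ((C₂ • (D • W').quadraticTwist d).baseChange F).IsElliptic := by
      rw [WeierstrassCurve.baseChange]; infer_instance
    exact ((C₂ • (D • W').quadraticTwist d).baseChange F).Δ'.ne_zero (by rw [coe_Δ', hrel])
  have hu1 : ‖((C₂.map (algebraMap ℚ F) * ((untwistAt hθ'0)⁻¹ * D.map (algebraMap ℚ F))).u : F)‖ = 1 := by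
    set u : F := ((C₂.map (algebraMap ℚ F) * ((untwistAt hθ'0)⁻¹ * D.map (algebraMap ℚ F))).u : F) with hudef
    have hrel : ((C₂ • (D • W').quadraticTwist d).baseChange F).Δ = (u⁻¹) ^ 12 * (W'.baseChange F).Δ := by
      rw [← hCV, variableChange_Δ, Units.val_inv_eq_inv_val]
    rw [hrel, norm_mul, norm_pow, norm_inv] at hΔn
    have h12 : ‖u‖⁻¹ ^ 12 = 1 := by
      have h' : ‖u‖⁻¹ ^ 12 * ‖(W'.baseChange F).Δ‖ = 1 * ‖(W'.baseChange F).Δ‖ := by rw [one_mul]; exact hΔn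
      exact mul_right_cancel₀ (norm_ne_zero_iff.mpr hΔ0) h'
    have h1 : ‖u‖⁻¹ = 1 := (pow_eq_one_iff_of_nonneg (inv_nonneg.mpr (norm_nonneg _)) (by norm_num)).mp h12
    exact inv_eq_one.mp h1
  have hu : 1 ≤ NormedField.valuation
      (((C₂.map (algebraMap ℚ F) * ((untwistAt hθ'0)⁻¹ * D.map (algebraMap ℚ F))).u : F)) := by
    rw [NormedField.valuation_apply, ← NNReal.coe_le_coe, coe_nnnorm, NNReal.coe_one, hu1]
  -- Step D: the change-of-variables rule for `log_ω`
  have key := padicLogPointFiniteExt_pointMap_of_variableChange_of_one_le_of_completeSpace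
    (V := W'.baseChange F) hp0' hp1' hu hm hmQ
  rw [← hlogQ, compositeChange_u (L := F) D C₂ hθ'0] at key
  -- solve for `log z`
  have hu0 : algebraMap ℚ F (C₂.u * D.u : ℚ) ≠ 0 := by
    rw [map_ne_zero]; exact mul_ne_zero C₂.u.ne_zero D.u.ne_zero
  have e1 : padicLogPointFiniteExt NormedField.valuation (W'.baseChange F) p
        (WeierstrassCurve.Affine.Point.map j.toRatAlgHom z) =
      ((algebraMap ℚ F (C₂.u * D.u : ℚ)) * (j θ)⁻¹)⁻¹ *
        e (logOmega (C₂ • (D • W').quadraticTwist d) p ι_p Q) := by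
    rw [key, ← mul_assoc, inv_mul_cancel₀ (mul_ne_zero hu0 (inv_ne_zero hθ'0)), one_mul]
  refine ⟨?_, ?_⟩
  · -- `λ = u⁻¹`
    have hlam : j θ * (algebraMap ℚ F (C₂.u * D.u : ℚ))⁻¹ =
        (((C₂.map (algebraMap ℚ F) * ((untwistAt hθ'0)⁻¹ * D.map (algebraMap ℚ F))).u : F))⁻¹ := by
      rw [compositeChange_u (L := F) D C₂ hθ'0, mul_inv, inv_inv, mul_comm]
    rw [hlam, norm_inv, hu1, inv_one]
  · rw [e1, mul_inv, inv_inv, mul_comm (algebraMap ℚ F (C₂.u * D.u : ℚ))⁻¹]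

end Descent

/-! ## §2 `‖Δ_{W₁}‖ = ‖Δ_W‖` for a twist by a `p`-unit at odd `p` -/

section Discriminant

variable (p : ℕ) [Fact p.Prime] {F : Type} [NontriviallyNormedField F] [CharZero F]
  (e : ℚ_[p] →+* F) (he : ∀ x, ‖e x‖ = ‖x‖)

include he in
/-- **Minimal discriminants of a twist pair have the same `p`-adic norm when `p` is odd and prime to the twist**: for globally minimal
`W`, `W₁` over `ℚ` with `C • W^{(d₁)} = W₁`, `p ≠ 2`, `p ∤ d₁`: `v_p(Δ_min W₁) ≤ v_p(Δ_min W) + 6 v_p(4d₁) = v_p(Δ_min W)`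
(`ManinAdditive.padicValInt_minimalDiscriminantInt_le_of_smul_quadraticTwist`) and symmetrically along the reverse isomorphism
`C′ • W₁^{(d₁)} = W`, so `‖Δ_{W₁}‖ = ‖Δ_W‖` read in any `F ⊇ ℚ_p`. [cite: SilvermanAEC2009, VII.1 Prop. 1.3 and X.5 Cor. 5.4] -/
theorem norm_Δ_baseChange_eq_of_twist (hp2 : p ≠ 2) {d₁ : ℤ} (hpd : ¬ (p : ℤ) ∣ d₁) (hd0 : d₁ ≠ 0)
    (W W₁ : WeierstrassCurve ℚ) [W.IsElliptic] [W.IsGloballyMinimal] [W₁.IsElliptic] [W₁.IsGloballyMinimal]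
    (C : VariableChange ℚ) (hC : C • W.quadraticTwist (d₁ : ℚ) = W₁) :
    ‖(W₁.baseChange F).Δ‖ = ‖(W.baseChange F).Δ‖ := by
  have hp : p.Prime := Fact.out
  have hdQ : (d₁ : ℚ) ≠ 0 := by exact_mod_cast hd0
  obtain ⟨C', hC'⟩ := SchneiderFree.exists_smul_quadraticTwist_eq_of_smul_quadraticTwist_eq W W₁ hdQ C hC
  have h1 := ManinAdditive.padicValInt_minimalDiscriminantInt_le_of_smul_quadraticTwist hd0 C hC p
  have h2 := ManinAdditive.padicValInt_minimalDiscriminantInt_le_of_smul_quadraticTwist hd0 C' hC' p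
  -- `v_p(4 d₁) = 0`
  have hp4 : ¬ (p : ℤ) ∣ 4 * d₁ := by
    intro h
    have hpZ : Prime (p : ℤ) := Nat.prime_iff_prime_int.mp hp
    rcases hpZ.dvd_or_dvd h with h4 | hd
    · have h4' : p ∣ 2 ^ 2 := by exact_mod_cast h4
      exact hp2 ((Nat.prime_dvd_prime_iff_eq hp Nat.prime_two).mp (hp.dvd_of_dvd_pow h4'))
    · exact hpd hd
  have h4 : padicValInt p (4 * d₁) = 0 := padicValInt.eq_zero_of_not_dvd hp4
  have heq : padicValInt p W₁.minimalDiscriminantInt = padicValInt p W.minimalDiscriminantInt := by omega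
  -- norms of minimal discriminants in `F`
  have key : ∀ (X : WeierstrassCurve ℚ) [X.IsGloballyMinimal],
      ‖(X.baseChange F).Δ‖ = ((padicNorm p (minimalDiscriminantInt X : ℚ) : ℚ) : ℝ) := by
    intro X _
    have eΔ : (X.baseChange F).Δ = e ((minimalDiscriminantInt X : ℚ) : ℚ_[p]) := by
      rw [WeierstrassCurve.baseChange, WeierstrassCurve.map_Δ, ← cast_minimalDiscriminantInt, map_ratCast,
        eq_ratCast]
    rw [eΔ, he, Padic.eq_padicNorm]
  have hne : (W.minimalDiscriminantInt : ℚ) ≠ 0 := by exact_mod_cast W.minimalDiscriminantInt_ne_zero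
  have hne₁ : (W₁.minimalDiscriminantInt : ℚ) ≠ 0 := by exact_mod_cast W₁.minimalDiscriminantInt_ne_zero
  rw [key W₁, key W, padicNorm.eq_zpow_of_nonzero hne, padicNorm.eq_zpow_of_nonzero hne₁, padicValRat.of_int,
    padicValRat.of_int, heq]

end Discriminant

/-! ## §3 The logarithm transport on the twisted road (`LogTransportTwistedR0`) -/

section Transport

/-- ★ **THE LOGARITHM TRANSPORT ON THE TWISTED ROAD** — the statement `LogTransportTwistedR0` of the skeleton v41 of crux
`GordTwoRankZeroOffCaseOne` (line `three_field_road`), i.e. its registered kernel stub `stub_logTransportTwistedR0`, PROVED. For a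
twisted road field `K` at `q` (`TameRoadFieldTwisted W p q K`: `K` imaginary quadratic, `p` split, `q ≠ p` odd), `p ≠ 2`, the globally
minimal `W₁` with `C • E^{(q*)} = W₁`, an infinite place `w₀`, ANY `y ∈ W₁(H_K)` (`H_K = ringClassField K w₀.embedding 1`), a square root
`θ ∈ H_K` of `q*` with sign cocycle `s` and the character `ν = s` of `Gal(H_K/K)`: the Galois descent `Q ∈ E(K)` of `Φ(Σ_τ s(τ)τy)`
along the twist isomorphism `Φ = (C₂)_* ∘ ι_θ⁻¹ ∘ D_*` (presentation `E = C₂ • ((D • W₁) ⊗ χ_{q*})`, `exists_charNeTwoNF_presentation`;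
descent and height clause `[H_K:K]⁻¹ ĥ(Σ s(τ)τy) = ĥ(Q)` by `SchneiderFree.exists_descent_twistedHeegner`) satisfies, for every datum
`ι′ : ℚ̄_p ≃ ℂ` and degree-one `𝔭′ ∋ p` induced by `ι′`:
`heegnerCharLogSum ι′ w₀.embedding 1 W₁ ν y = λ · log_{ω_E}(Q)_{embAt K p 𝔭′}` with `‖λ‖ = 1`. Proof: the weighted sum is
`log_{ω_{W₁}}` of the twisted trace read in `ℂ_p` (`heegnerCharLogSum_eq_padicLog_map_sum`: every `H_K`-point has a multiple in the
level); the twist descent of the logarithm (§1) with `‖Δ_E‖_p = ‖Δ_{W₁}‖_p` (§2: `q*` is a `p`-unit, `p` odd); and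
`ι′⁻¹ ∘ w₀.embedding = embAt K p 𝔭′` on `K` (door cell's `symm_apply_eq_embAt_of_forall_mem_iff_norm_lt_one`, the conjugate prime
`𝔭̄′ ≠ 𝔭′` existing as `p` splits). [cite: SilvermanAEC2009, III.1 Table 3.1, Thm. IV.6.4 with Prop. VII.2.2, X.5 Cor. 5.4]
[cite: CastellaHsieh2018, §3.3 (arXiv:1505.08165 p. 9)] [cite: LiuZhangZhang2018, (1.5) (Duke 167 pp. 746–747)] -/
theorem logTransport_twisted :
    ∀ (W : WeierstrassCurve ℚ) [W.IsElliptic] [W.IsGloballyMinimal] (p : ℕ) [Fact p.Prime] (q : ℕ) [Fact q.Prime]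
    (K : Type) [Field K] [NumberField K], TameRoadFieldTwisted W p q K → p ≠ 2 →
    ∀ (W₁ : WeierstrassCurve ℚ) [W₁.IsElliptic] [W₁.IsGloballyMinimal]
    [(W₁.baseChange ℂ_[p]).IsIntegral (NormedField.valuation (K := ℂ_[p])).integer]
    (C : VariableChange ℚ), C • W.quadraticTwist (((-1 : ℤ) ^ (q / 2) * q : ℤ) : ℚ) = W₁ →
    ∀ (w₀ : InfinitePlace K) [NumberField (ringClassField K w₀.embedding 1)]
    (y : (W₁.baseChange (ringClassField K w₀.embedding 1)).toAffine.Point)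
    (θ : ringClassField K w₀.embedding 1),
    θ ^ 2 = ((((-1 : ℤ) ^ (q / 2) * q : ℤ)) : ringClassField K w₀.embedding 1) → θ ≠ 0 →
    ∀ (s : ringClassGal w₀.embedding 1 → ℤˣ),
    (∀ σ : ringClassGal w₀.embedding 1, σ.1 θ = ((s σ : ℤ) : ringClassField K w₀.embedding 1) * θ) →
    ∀ (ν : ringClassGal w₀.embedding 1 →* ℂˣ), (∀ σ, ((ν σ : ℂˣ) : ℂ) = ((s σ : ℤ) : ℂ)) →
    ∃ Q : (W.baseChange K).toAffine.Point,
      ((Module.finrank K (ringClassField K w₀.embedding 1) : ℝ))⁻¹ *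
          (∑ τ : ringClassGal w₀.embedding 1,
            (s τ : ℤ) • pointGalHom W₁ (ringClassField K w₀.embedding 1 : Type) τ.1 y).canonicalHeight =
        Q.canonicalHeight ∧
      ∀ (ι' : PadicAlgCl p ≃+* ℂ) (𝔭' : HeightOneSpectrum (𝓞 K)) (h𝔭' : ((p : ℕ) : 𝓞 K) ∈ 𝔭'.asIdeal)
        (he' : 𝔭'.asIdeal.ramificationIdx (𝓞 ℚ) = 1) (hf' : 𝔭'.asIdeal.inertiaDeg (𝓞 ℚ) = 1),
        (∀ (w : InfinitePlace K) (k : 𝓞 K), k ∈ 𝔭'.asIdeal ↔ ‖ι'.symm (w.embedding (k : K))‖ < 1) →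
        ∃ lam : ℂ_[p], ‖lam‖ = 1 ∧ heegnerCharLogSum ι' w₀.embedding 1 W₁ ν y =
          lam * algebraMap ℚ_[p] ℂ_[p] (logOmega W p (embAt K p 𝔭' h𝔭' he' hf') Q) := by
  intro W _ _ p _ q _ K _ _ hK hp2 W₁ _ _ _ C hC w₀ _ y θ hθ2 hθ0 s hθσ ν hν
  have hp : p.Prime := Fact.out
  have hq : q.Prime := Fact.out
  obtain ⟨hKiq, -, ⟨hqp, -, -, -, -⟩, -, -, -, hHp⟩ := hK
  have h2f : Module.finrank ℚ K = 2 := hKiq.1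
  have hsplit : SplitsIn K p := hHp p hp (dvd_refl p)
  -- the twist parameter `q* = (-1)^{(q-1)/2} q`, a `p`-unit (no `set`: abstraction over `ℂ_p`-terms is too expensive)
  have hd₁0 : ((-1 : ℤ) ^ (q / 2) * q : ℤ) ≠ 0 :=
    mul_ne_zero (pow_ne_zero _ (by norm_num)) (by exact_mod_cast hq.ne_zero)
  have hdQ : (((-1 : ℤ) ^ (q / 2) * q : ℤ) : ℚ) ≠ 0 := by exact_mod_cast hd₁0
  have hpd : ¬ (p : ℤ) ∣ ((-1 : ℤ) ^ (q / 2) * q : ℤ) := by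
    intro h
    have h' : (p : ℤ) ∣ (q : ℤ) := ((isUnit_neg_one (α := ℤ)).pow (q / 2)).dvd_mul_left.mp h
    exact hqp ((Nat.prime_dvd_prime_iff_eq hp hq).mp (Int.natCast_dvd_natCast.mp h')).symm
  -- the reverse presentation `E = C₂ • ((D • W₁) ⊗ χ_{q*})`, `D • W₁` in `a₁ = a₃ = 0` form
  obtain ⟨C', hC'⟩ := SchneiderFree.exists_smul_quadraticTwist_eq_of_smul_quadraticTwist_eq W W₁ hdQ C hC
  haveI hNF : ((@WeierstrassCurve.toCharNeTwoNF ℚ _ W₁ (invertibleOfNonzero two_ne_zero)) • W₁).IsCharNeTwoNF :=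
    @WeierstrassCurve.toCharNeTwoNF_spec ℚ _ W₁ (invertibleOfNonzero two_ne_zero)
  obtain ⟨C₂, hC₂⟩ := SchneiderFree.exists_charNeTwoNF_presentation W₁ W _ C' hC'
  generalize hDdef : @WeierstrassCurve.toCharNeTwoNF ℚ _ W₁ (invertibleOfNonzero two_ne_zero) = D at hNF hC₂
  subst hC₂
  -- the descended point with its height clause
  have hθ2' : θ ^ 2 = algebraMap ℚ (ringClassField K w₀.embedding 1) (((-1 : ℤ) ^ (q / 2) * q : ℤ) : ℚ) := by
    rw [hθ2, map_intCast]
  obtain ⟨Q, hQ, hheight, -⟩ := SchneiderFree.exists_descent_twistedHeegner w₀.embedding 1 hKiq one_ne_zero W₁ D C₂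
    hθ2' hθ0 ν s hν hθσ hdQ y
  refine ⟨Q, hheight, fun ι' 𝔭' h𝔭' he' hf' hcompat ↦ ?_⟩
  -- the two `p`-adic embeddings of `K` agree: `ι′⁻¹ ∘ w₀.embedding = embAt K p 𝔭′`
  obtain ⟨-, 𝔮, -, hne, h𝔮, -⟩ := LocalIndexTransport.exists_conj_prime_of_splitsIn K p h2f hsplit h𝔭'
  obtain ⟨he𝔮, hf𝔮⟩ := degreeOne_of_splitsIn h2f hsplit h𝔮
  have hind : ∀ k : 𝓞 K, k ∈ 𝔭'.asIdeal ↔ ‖ι'.symm (w₀.embedding (k : K))‖ < 1 := fun k ↦ hcompat w₀ k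
  have heC : ∀ x, ‖(algebraMap ℚ_[p] ℂ_[p] : ℚ_[p] →+* ℂ_[p]) x‖ = ‖x‖ := fun x ↦ norm_algebraMap' ℂ_[p] x
  have hj : ∀ x : K, ringClassFieldToPadicComplex (p := p) ι' w₀.embedding 1
        (algebraMap K (ringClassField K w₀.embedding 1) x) =
      (algebraMap ℚ_[p] ℂ_[p] : ℚ_[p] →+* ℂ_[p]) (embAt K p 𝔭' h𝔭' he' hf' x) := by
    intro x
    have e1 : ringClassFieldToPadicComplex (p := p) ι' w₀.embedding 1
        (algebraMap K (ringClassField K w₀.embedding 1) x) =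
      algebraMap (PadicAlgCl p) ℂ_[p]
        (ι'.symm ((algebraMap K (ringClassField K w₀.embedding 1) x : ringClassField K w₀.embedding 1) : ℂ)) :=
      rfl
    rw [e1, coe_algebraMap_ringClassField,
      KYRead.LogDescent.symm_apply_eq_embAt_of_forall_mem_iff_norm_lt_one h2f h𝔮 he𝔮 hf𝔮 h𝔭' he' hf' hne ι'
        w₀.embedding hind x,
      ← IsScalarTower.algebraMap_apply]
  -- the weighted logarithm sum is the logarithm of the twisted trace
  obtain ⟨-, hlog⟩ := heegnerCharLogSum_eq_padicLog_map_sum p ι' w₀.embedding 1 W₁ ν s hν y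
  -- `‖Δ_E‖ = ‖Δ_{W₁}‖` in `ℂ_p`
  have hΔn : ‖((C₂ • (D • W₁).quadraticTwist (((-1 : ℤ) ^ (q / 2) * q : ℤ) : ℚ)).baseChange ℂ_[p]).Δ‖ =
      ‖(W₁.baseChange ℂ_[p]).Δ‖ :=
    (norm_Δ_baseChange_eq_of_twist p (algebraMap ℚ_[p] ℂ_[p] : ℚ_[p] →+* ℂ_[p]) heC hp2 hpd hd₁0
      (C₂ • (D • W₁).quadraticTwist (((-1 : ℤ) ^ (q / 2) * q : ℤ) : ℚ)) W₁ C hC).symm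
  -- the twist descent of the logarithm
  obtain ⟨hlam, hdesc⟩ := padicLog_map_eq_mul_logOmega_of_descent_of_norm_Δ_eq p W₁ D C₂
    (((-1 : ℤ) ^ (q / 2) * q : ℤ) : ℚ) hθ2' hθ0 _ Q (by convert hQ) (embAt K p 𝔭' h𝔭' he' hf')
    (algebraMap ℚ_[p] ℂ_[p] : ℚ_[p] →+* ℂ_[p]) heC (ringClassFieldToPadicComplex (p := p) ι' w₀.embedding 1) hj hΔn
  -- (`Eq.trans` unifies the two spellings of the `ℂ_p`-instances up to definitional equality; `rw` would not)
  exact ⟨_, hlam, hlog.trans hdesc⟩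

end Transport

end Summit.BirchSwinnertonDyer.BirchSwinnertonDyer.Theorems.TwistedWanRoad

end
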